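import Mathlib
import Literature.Analysis.SpecialFunctions.LegendrePolynomials
import Literature.Analysis.SpecialFunctions.LegendrePolynomialsBonnet
import Literature.Analysis.SpecialFunctions.LegendreZeros
import Literature.Analysis.SpecialFunctions.GaussLegendreQuadrature
import HarnessLib

/-!
# Root isolation by disjoint sign changes, certified Gauss–Legendre nodes, and the exact integer
# sign test `B_k = 2^{k(e+1)} P_k(m 2^{-e})`

Topic `Literature/Analysis/ValidatedNumerics`. Everything here is PROVED; no named fact, no axiom.

**The certification principle** (`existsUnique_isRoot_mem_Icc_of_sign_changes`,
`exists_mem_Ioo_of_isRoot_of_sign_changes`, `roots_nodup_and_card_of_sign_changes`,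
`rootMultiplicity_eq_one_of_sign_changes`): if a nonzero real polynomial `p` of degree `n` changes
sign strictly (`p(aᵢ) p(bᵢ) < 0`) across each of `n` pairwise disjoint brackets `[aᵢ, bᵢ]`
(indexed by any finite type of cardinality `n = deg p`), then each bracket contains EXACTLY ONE zero
of `p`, strictly inside; `p` has no zero outside the brackets; and all `n` zeros of `p` are real and
simple.  Proof: the intermediate value theorem puts a zero inside each bracket, disjointness makes
them `n` distinct zeros, and a polynomial of degree `n` has at most `n` roots counted with
multiplicity (`Polynomial.card_roots'`), so these are all the roots, each of multiplicity one.
Elementary and standard (the termination argument of every bisection / sign-variation real-root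
isolator); recorded here because it is the soundness statement of a concrete certified computation.

**Certified Gauss–Legendre nodes** (`existsUnique_gaussLegendreNode_mem_Icc`,
`exists_gaussLegendreNode_mem_Ioo`): the case `p = P_n` (`legendre n`, `deg P_n = n`,
`natDegree_legendre`), whose zeros are the nodes `gaussLegendreNodes n` of the `n`-point
Gauss–Legendre rule [Szegő Thm. 3.3.1: `n` real simple zeros in `(-1, 1)`, the tree's
`legendre_roots`; the sign-change counting is Szegő's own in §3.3 (5)–(6)]: `n` disjoint brackets with strict sign changes of `P_n` enclose exactly the `n`
nodes, one each.

**The exact sign test** (`legendreB`, `legendreB_zero`, `legendreB_one`, `legendreB_rec`,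
`legendreB_pos_iff` / `_neg_iff` / `_eq_zero_iff`, `exists_int_legendreB`): for a dyadic point
`x = m 2^{-e}` put `B_k := 2^{k(e+1)} P_k(x)`.  Then `B_0 = 1`, `B_1 = 2m`, Bonnet's recursion
[Jeffrey §18.2.5.1 (1)] scales to the recursion
`(k+2) B_{k+2} = (2k+3)(2m) B_{k+1} - (k+1) 4^{e+1} B_k` with INTEGER coefficients, `B_k` has the
sign of `P_k(x)`, and `B_k` is an integer (`2ᵏ P_k ∈ ℤ[X]` by Rodrigues' formula:
`2ᵏ coeff_i(P_k) = C(i+k, k) · coeff_{i+k}((X²-1)ᵏ)`, `exists_int_two_pow_mul_coeff_legendre`) — so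
the recursion can be run in exact integer arithmetic, the division by `k+2` leaving no remainder,
and the sign of `P_n` at the bracket endpoints is decided with no rounding anywhere.

Motivation and first use: this is the soundness content of the H21 engines group's
`cap.special.gauss_legendre(n, prec)` / `verify_gauss_legendre` / `legendre_B` /
`legendre_sign_exact` (certified `n`-point Gauss–Legendre rules over a dyadic interval kernel: node
isolation by an exact-integer sign change of `P_n` on `n` pairwise disjoint intervals; the weights
are then enclosed on each node interval by the two formulas of
`Literature/Analysis/SpecialFunctions/LegendreDifferentialRelation.lean` /
`GaussLegendreQuadrature.lean`).  Shared numerical engines serve client cells; rigour lives in the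
verifiers; nothing in this file is a claim about any engine output — it states what a successful
run of such a check proves.

NOT here: interval-arithmetic enclosure of the recurrences (generic, see `IntervalPolynomial.lean`);
Sturm / Descartes–Vincent root isolation (Mathlib has Descartes' rule of signs,
`Polynomial.roots_countP_pos_le_signVariations`); complex root enclosures.

## References

* G. Szegő, *Orthogonal Polynomials*, AMS Colloquium Publications 23 (1939; 4th ed. 1975),
  Thm. 3.3.1. [cite: Szego1939, Thm. 3.3.1]
* A. Jeffrey, *Handbook of Mathematical Formulas and Integrals*, Academic Press 1995, §18.2.2.1 (1)
  (Rodrigues), §18.2.4.2 (1)–(2) (`P_0, P_1`), §18.2.5.1 (1) (Bonnet) (held copy, pp. 178–179).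
  [cite: Jeffrey1995, §18.2.5.1 (1)]

AI-produced formalisation (H21 engines group, seat eng-cap-1 gen 18, 2026-08-21); no facts, no
axioms, no `sorry`.
-/

noncomputable section

open Polynomial Set Finset
open Literature.Analysis.SpecialFunctions

namespace Literature.Analysis.ValidatedNumerics

variable {ι : Type*} [Fintype ι]

/-- Core of the certification principle: one root strictly inside each bracket, the map is
injective, and these are all the roots, each simple. [folklore] -/
private theorem exists_roots_of_sign_changes {p : ℝ[X]} (hp : p ≠ 0)
    (hcard : Fintype.card ι = p.natDegree) {a b : ι → ℝ} (hab : ∀ i, a i ≤ b i)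
    (hsign : ∀ i, p.eval (a i) * p.eval (b i) < 0)
    (hdisj : Pairwise fun i j => Disjoint (Icc (a i) (b i)) (Icc (a j) (b j))) :
    ∃ r : ι → ℝ, Function.Injective r ∧ (∀ i, r i ∈ Ioo (a i) (b i) ∧ p.IsRoot (r i)) ∧
      (∀ x, p.IsRoot x → ∃ i, x = r i) ∧ p.roots.Nodup := by
  classical
  -- one root in each open bracket, by the intermediate value theorem
  have hex : ∀ i, ∃ x, x ∈ Ioo (a i) (b i) ∧ p.IsRoot x := by
    intro i
    have hcont : ContinuousOn (fun x => p.eval x) (Icc (a i) (b i)) :=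
      (Polynomial.continuous p).continuousOn
    have h0 : (0 : ℝ) ∈ (fun x => p.eval x) '' Icc (a i) (b i) := by
      rcases mul_neg_iff.mp (hsign i) with ⟨ha, hb⟩ | ⟨ha, hb⟩
      · exact intermediate_value_Icc' (hab i) hcont ⟨hb.le, ha.le⟩
      · exact intermediate_value_Icc (hab i) hcont ⟨ha.le, hb.le⟩
    obtain ⟨x, hx, hx0⟩ := h0
    have hxa : x ≠ a i := by
      rintro rfl; have := hsign i; rw [show p.eval (a i) = 0 from hx0, zero_mul] at this
      exact lt_irrefl _ this
    have hxb : x ≠ b i := by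
      rintro rfl; have := hsign i; rw [show p.eval (b i) = 0 from hx0, mul_zero] at this
      exact lt_irrefl _ this
    exact ⟨x, ⟨lt_of_le_of_ne hx.1 hxa.symm, lt_of_le_of_ne hx.2 hxb⟩, hx0⟩
  choose r hr using hex
  have hinj : Function.Injective r := by
    intro i j hij
    by_contra hne
    have hi : r i ∈ Icc (a i) (b i) := Ioo_subset_Icc_self (hr i).1
    have hj : r i ∈ Icc (a j) (b j) := hij ▸ Ioo_subset_Icc_self (hr j).1
    exact Set.disjoint_left.mp (hdisj hne) hi hj
  -- counting: `n` distinct roots of a polynomial of degree `n` are all its roots, each simple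
  set S : Finset ℝ := Finset.univ.image r with hS
  have hScard : S.card = p.natDegree := by
    rw [hS, Finset.card_image_of_injective _ hinj, Finset.card_univ, hcard]
  have hSsub : S ⊆ p.roots.toFinset := by
    intro x hx
    obtain ⟨i, -, rfl⟩ := Finset.mem_image.mp hx
    exact Multiset.mem_toFinset.mpr ((mem_roots hp).mpr (hr i).2)
  have hle : p.roots.toFinset.card ≤ p.natDegree :=
    (Multiset.toFinset_card_le _).trans (card_roots' _)
  have heq : p.roots.toFinset = S :=
    (Finset.eq_of_subset_of_card_le hSsub (by rw [hScard]; exact hle)).symm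
  have hdedup : p.roots.dedup = p.roots :=
    Multiset.eq_of_le_of_card_le (Multiset.dedup_le _) (by
      calc Multiset.card p.roots ≤ p.natDegree := card_roots' _
        _ = Multiset.card p.roots.dedup := by rw [← Multiset.card_toFinset, heq, hScard])
  refine ⟨r, hinj, hr, fun x hx => ?_, hdedup ▸ Multiset.nodup_dedup _⟩
  have hxS : x ∈ S := heq ▸ Multiset.mem_toFinset.mpr ((mem_roots hp).mpr hx)
  obtain ⟨i, -, hi⟩ := Finset.mem_image.mp hxS
  exact ⟨i, hi.symm⟩

/-- **Root isolation by disjoint sign changes** (the certification principle behind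
`cap.special.gauss_legendre` / `verify_gauss_legendre`): if a nonzero real polynomial `p` of
degree `n` changes sign strictly across each of `n` pairwise disjoint brackets `[aᵢ, bᵢ]`
(`p(aᵢ) p(bᵢ) < 0`), then each bracket contains EXACTLY ONE zero of `p` (and that zero is
interior).  This is the counting argument of Szegő §3.3 (5)–(6) (proofs of Thms. 3.3.2–3.3.3: a strict
sign change brackets an odd number of zeros, and the degree bound makes `n` disjoint brackets
exhaustive, one simple zero each). [cite: Szego1939, §3.3 (5)–(6), proofs of Thms. 3.3.2–3.3.3] -/
theorem existsUnique_isRoot_mem_Icc_of_sign_changes {p : ℝ[X]} (hp : p ≠ 0)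
    (hcard : Fintype.card ι = p.natDegree) {a b : ι → ℝ} (hab : ∀ i, a i ≤ b i)
    (hsign : ∀ i, p.eval (a i) * p.eval (b i) < 0)
    (hdisj : Pairwise fun i j => Disjoint (Icc (a i) (b i)) (Icc (a j) (b j))) (i : ι) :
    ∃! x, x ∈ Icc (a i) (b i) ∧ p.IsRoot x := by
  obtain ⟨r, hinj, hr, hall, -⟩ := exists_roots_of_sign_changes hp hcard hab hsign hdisj
  refine ⟨r i, ⟨Ioo_subset_Icc_self (hr i).1, (hr i).2⟩, fun y hy => ?_⟩
  obtain ⟨j, rfl⟩ := hall y hy.2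
  by_contra hne
  have hji : j ≠ i := fun h => hne (congrArg r h)
  exact Set.disjoint_left.mp (hdisj hji) (Ioo_subset_Icc_self (hr j).1) hy.1

/-- … and `p` has NO zero outside the brackets: every zero of `p` lies strictly inside one of
them. [cite: Szego1939, §3.3 (5)–(6), proofs of Thms. 3.3.2–3.3.3] -/
theorem exists_mem_Ioo_of_isRoot_of_sign_changes {p : ℝ[X]} (hp : p ≠ 0)
    (hcard : Fintype.card ι = p.natDegree) {a b : ι → ℝ} (hab : ∀ i, a i ≤ b i)
    (hsign : ∀ i, p.eval (a i) * p.eval (b i) < 0)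
    (hdisj : Pairwise fun i j => Disjoint (Icc (a i) (b i)) (Icc (a j) (b j)))
    {x : ℝ} (hx : p.IsRoot x) : ∃ i, x ∈ Ioo (a i) (b i) := by
  obtain ⟨r, -, hr, hall, -⟩ := exists_roots_of_sign_changes hp hcard hab hsign hdisj
  obtain ⟨i, rfl⟩ := hall x hx
  exact ⟨i, (hr i).1⟩

/-- … and all `n` zeros of `p` are then real and simple: `p.roots` (the real roots with
multiplicity) has no repetition and exactly `n = deg p` elements.
[cite: Szego1939, §3.3 (5)–(6), proofs of Thms. 3.3.2–3.3.3] -/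
theorem roots_nodup_and_card_of_sign_changes {p : ℝ[X]} (hp : p ≠ 0)
    (hcard : Fintype.card ι = p.natDegree) {a b : ι → ℝ} (hab : ∀ i, a i ≤ b i)
    (hsign : ∀ i, p.eval (a i) * p.eval (b i) < 0)
    (hdisj : Pairwise fun i j => Disjoint (Icc (a i) (b i)) (Icc (a j) (b j))) :
    p.roots.Nodup ∧ Multiset.card p.roots = p.natDegree := by
  classical
  obtain ⟨r, hinj, hr, hall, hnd⟩ := exists_roots_of_sign_changes hp hcard hab hsign hdisj
  refine ⟨hnd, le_antisymm (card_roots' _) ?_⟩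
  calc p.natDegree = (Finset.univ.image r).card := by
        rw [Finset.card_image_of_injective _ hinj, Finset.card_univ, hcard]
    _ ≤ p.roots.toFinset.card := Finset.card_le_card (by
        intro x hx
        obtain ⟨i, -, rfl⟩ := Finset.mem_image.mp hx
        exact Multiset.mem_toFinset.mpr ((mem_roots hp).mpr (hr i).2))
    _ ≤ Multiset.card p.roots := Multiset.toFinset_card_le _

/-- In particular every zero of such a `p` has multiplicity exactly one.
[cite: Szego1939, §3.3 (5)–(6), proofs of Thms. 3.3.2–3.3.3] -/
theorem rootMultiplicity_eq_one_of_sign_changes {p : ℝ[X]} (hp : p ≠ 0)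
    (hcard : Fintype.card ι = p.natDegree) {a b : ι → ℝ} (hab : ∀ i, a i ≤ b i)
    (hsign : ∀ i, p.eval (a i) * p.eval (b i) < 0)
    (hdisj : Pairwise fun i j => Disjoint (Icc (a i) (b i)) (Icc (a j) (b j)))
    {x : ℝ} (hx : p.IsRoot x) : p.rootMultiplicity x = 1 := by
  classical
  have hnd := (roots_nodup_and_card_of_sign_changes hp hcard hab hsign hdisj).1
  have h1 : p.rootMultiplicity x ≤ 1 := by
    rw [← count_roots]; exact Multiset.nodup_iff_count_le_one.mp hnd x
  have h2 : 0 < p.rootMultiplicity x := (rootMultiplicity_pos hp).mpr hx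
  omega

/-! ### The Legendre case: certified brackets enclose exactly the Gauss–Legendre nodes -/

/-- **Certified Gauss–Legendre nodes.** If `P_n` changes sign strictly across each of `n`
pairwise disjoint brackets `[aᵢ, bᵢ]`, then each bracket contains exactly one Gauss–Legendre node
of order `n` (a zero of `P_n`; `gaussLegendreNodes`), strictly inside it — the node-isolation step
of `cap.special.gauss_legendre(n, prec)` and of `verify_gauss_legendre` (there the sign of `P_n` at
the dyadic endpoints is decided exactly by `legendreB`, below). [cite: Szego1939, Thm. 3.3.1] -/
theorem existsUnique_gaussLegendreNode_mem_Icc {n : ℕ} (hcard : Fintype.card ι = n)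
    {a b : ι → ℝ} (hab : ∀ i, a i ≤ b i)
    (hsign : ∀ i, (legendre n).eval (a i) * (legendre n).eval (b i) < 0)
    (hdisj : Pairwise fun i j => Disjoint (Icc (a i) (b i)) (Icc (a j) (b j))) (i : ι) :
    ∃! x, x ∈ Icc (a i) (b i) ∧ x ∈ gaussLegendreNodes n := by
  have hc : Fintype.card ι = (legendre n).natDegree := by rw [natDegree_legendre, hcard]
  simpa only [mem_gaussLegendreNodes_iff] using
    existsUnique_isRoot_mem_Icc_of_sign_changes (legendre_ne_zero n) hc hab hsign hdisj i

/-- … and the brackets miss no node: every Gauss–Legendre node of order `n` lies strictly inside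
one of them (so the `n` certified node intervals, sorted, ARE the rule's nodes in order).
[cite: Szego1939, Thm. 3.3.1] -/
theorem exists_gaussLegendreNode_mem_Ioo {n : ℕ} (hcard : Fintype.card ι = n)
    {a b : ι → ℝ} (hab : ∀ i, a i ≤ b i)
    (hsign : ∀ i, (legendre n).eval (a i) * (legendre n).eval (b i) < 0)
    (hdisj : Pairwise fun i j => Disjoint (Icc (a i) (b i)) (Icc (a j) (b j)))
    {x : ℝ} (hx : x ∈ gaussLegendreNodes n) : ∃ i, x ∈ Ioo (a i) (b i) := by
  have hc : Fintype.card ι = (legendre n).natDegree := by rw [natDegree_legendre, hcard]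
  exact exists_mem_Ioo_of_isRoot_of_sign_changes (legendre_ne_zero n) hc hab hsign hdisj
    (mem_gaussLegendreNodes_iff.mp hx)

/-! ### The exact integer sign test `B_k = 2^{k(e+1)} P_k(m 2^{-e})` -/

/-- `B_k(m, e) := 2^{k(e+1)} · P_k(m / 2^e)`, the scaled value of `P_k` at the dyadic point
`x = m 2^{-e}` that `cap.special.legendre_B` computes in integer arithmetic (non-Prop plumbing def).
[folklore] -/
def legendreB (m : ℤ) (e k : ℕ) : ℝ := 2 ^ (k * (e + 1)) * (legendre k).eval ((m : ℝ) / 2 ^ e)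

/-- `B_0 = 1` (`P_0 = 1`). [cite: Jeffrey1995, §18.2.4.2 (1)] -/
theorem legendreB_zero (m : ℤ) (e : ℕ) : legendreB m e 0 = 1 := by
  simp [legendreB, legendre_zero]

/-- `B_1 = 2m` (`P_1 = x`). [cite: Jeffrey1995, §18.2.4.2 (2)] -/
theorem legendreB_one (m : ℤ) (e : ℕ) : legendreB m e 1 = 2 * m := by
  simp only [legendreB, legendre_one, eval_X, one_mul, pow_succ]
  have h : (2 : ℝ) ^ e ≠ 0 := by positivity
  field_simp

/-- **The integer recurrence of `legendre_B`**:
`(k+2) B_{k+2} = (2k+3)(2m) B_{k+1} - (k+1) 4^{e+1} B_k` (Bonnet's recursion scaled by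
`2^{(k+2)(e+1)}`; in the code `(k+1) B_{k+1} = (2k+1)(2m) B_k - k·4^{e+1} B_{k-1}`).
[cite: Jeffrey1995, §18.2.5.1 (1)] -/
theorem legendreB_rec (m : ℤ) (e k : ℕ) :
    ((k : ℝ) + 2) * legendreB m e (k + 2) =
      (2 * (k : ℝ) + 3) * (2 * m) * legendreB m e (k + 1) -
        ((k : ℝ) + 1) * 4 ^ (e + 1) * legendreB m e k := by
  have h : ((k : ℝ) + 2) * (legendre (k + 2)).eval ((m : ℝ) / 2 ^ e) =
      (2 * (k : ℝ) + 3) * ((m : ℝ) / 2 ^ e) * (legendre (k + 1)).eval ((m : ℝ) / 2 ^ e) -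
        ((k : ℝ) + 1) * (legendre k).eval ((m : ℝ) / 2 ^ e) := by
    have h0 := congrArg (fun q => q.eval ((m : ℝ) / 2 ^ e)) (legendre_succ_succ k)
    simpa only [eval_mul, eval_C, eval_X, eval_sub] using h0
  set t : ℝ := 2 ^ (e + 1) with ht
  have h2 : (2 : ℝ) ^ e ≠ 0 := by positivity
  have hpow : ∀ j : ℕ, (2 : ℝ) ^ (j * (e + 1)) = t ^ j := fun j => by rw [ht, ← pow_mul, mul_comm]
  have h4 : (4 : ℝ) ^ (e + 1) = t ^ 2 := by
    rw [ht, ← pow_mul, mul_comm, pow_mul]; norm_num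
  have hxt : ((m : ℝ) / 2 ^ e) * t = 2 * m := by
    rw [ht, pow_succ]; field_simp
  simp only [legendreB, hpow, h4]
  calc ((k : ℝ) + 2) * (t ^ (k + 2) * (legendre (k + 2)).eval ((m : ℝ) / 2 ^ e))
      = t ^ (k + 2) * (((k : ℝ) + 2) * (legendre (k + 2)).eval ((m : ℝ) / 2 ^ e)) := by ring
    _ = t ^ (k + 2) * ((2 * (k : ℝ) + 3) * ((m : ℝ) / 2 ^ e) * (legendre (k + 1)).eval ((m : ℝ) / 2 ^ e)
          - ((k : ℝ) + 1) * (legendre k).eval ((m : ℝ) / 2 ^ e)) := by rw [h]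
    _ = (2 * (k : ℝ) + 3) * (((m : ℝ) / 2 ^ e) * t) * (t ^ (k + 1) * (legendre (k + 1)).eval ((m : ℝ) / 2 ^ e))
          - ((k : ℝ) + 1) * t ^ 2 * (t ^ k * (legendre k).eval ((m : ℝ) / 2 ^ e)) := by ring
    _ = _ := by rw [hxt]

/-- **Soundness of `legendre_sign_exact`**: `B_k` and `P_k(m 2^{-e})` have the same sign —
`B_k > 0 ↔ P_k(x) > 0` (a positive scaling of the value given by Bonnet's recursion).
[cite: Jeffrey1995, §18.2.5.1 (1)] -/
theorem legendreB_pos_iff (m : ℤ) (e k : ℕ) :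
    0 < legendreB m e k ↔ 0 < (legendre k).eval ((m : ℝ) / 2 ^ e) := by
  unfold legendreB
  exact mul_pos_iff_of_pos_left (by positivity)

/-- `B_k < 0 ↔ P_k(x) < 0`. [cite: Jeffrey1995, §18.2.5.1 (1)] -/
theorem legendreB_neg_iff (m : ℤ) (e k : ℕ) :
    legendreB m e k < 0 ↔ (legendre k).eval ((m : ℝ) / 2 ^ e) < 0 := by
  unfold legendreB
  have h : (0 : ℝ) < 2 ^ (k * (e + 1)) := by positivity
  constructor
  · intro hlt
    rcases lt_or_ge ((legendre k).eval ((m : ℝ) / 2 ^ e)) 0 with h' | h'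
    · exact h'
    · exact absurd hlt (not_lt.mpr (mul_nonneg h.le h'))
  · exact fun hlt => mul_neg_of_pos_of_neg h hlt

/-- `B_k = 0 ↔ P_k(x) = 0`. [cite: Jeffrey1995, §18.2.5.1 (1)] -/
theorem legendreB_eq_zero_iff (m : ℤ) (e k : ℕ) :
    legendreB m e k = 0 ↔ (legendre k).eval ((m : ℝ) / 2 ^ e) = 0 := by
  unfold legendreB
  have h : (2 : ℝ) ^ (k * (e + 1)) ≠ 0 := by positivity
  rw [mul_eq_zero, or_iff_right h]

/-- `2ᵏ P_k ∈ ℤ[X]`: `2ᵏ · coeff_i(P_k) = C(i+k, k) · coeff_{i+k}((X²-1)ᵏ)` is an integer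
(Rodrigues' formula [Jeffrey §18.2.2.1 (1)]: `dᵏ/dxᵏ` of an integer polynomial is coefficientwise
divisible by `k!`). [cite: Jeffrey1995, §18.2.2.1 (1)] -/
theorem exists_int_two_pow_mul_coeff_legendre (k i : ℕ) :
    ∃ z : ℤ, (2 : ℝ) ^ k * (legendre k).coeff i = z := by
  have hW : legendreW k = Polynomial.map (Int.castRingHom ℝ) ((X ^ 2 - 1) ^ k) := by
    simp [legendreW, Polynomial.map_pow, Polynomial.map_sub]
  refine ⟨((i + k).choose k : ℤ) * ((X ^ 2 - 1 : ℤ[X]) ^ k).coeff (i + k), ?_⟩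
  rw [legendre, coeff_C_mul, coeff_iterate_derivative, hW, coeff_map,
    Nat.descFactorial_eq_factorial_mul_choose, nsmul_eq_mul]
  have hf : (k.factorial : ℝ) ≠ 0 := by positivity
  rw [eq_intCast]
  push_cast
  field_simp

/-- **`legendre_B` is exact**: `B_k(m, e) = 2^{k(e+1)} P_k(m 2^{-e})` is an INTEGER (the code's
"cannot happen: B_k are integers" — its division by `k+1` leaves no remainder).
`B_k = Σ_{i ≤ k} (2ᵏ coeff_i P_k) · 2^{e(k-i)} · mⁱ`. [cite: Jeffrey1995, §18.2.2.1 (1)] -/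
theorem exists_int_legendreB (m : ℤ) (e k : ℕ) : ∃ z : ℤ, legendreB m e k = z := by
  choose z hz using fun i => exists_int_two_pow_mul_coeff_legendre k i
  refine ⟨∑ i ∈ Finset.range (k + 1), z i * (2 ^ (e * (k - i)) * m ^ i), ?_⟩
  unfold legendreB
  rw [eval_eq_sum_range' (n := k + 1) (by rw [natDegree_legendre]; omega), Finset.mul_sum]
  push_cast
  refine Finset.sum_congr rfl fun i hi => ?_
  have hik : i ≤ k := Nat.lt_succ_iff.mp (Finset.mem_range.mp hi)
  rw [← hz i]
  obtain ⟨d, rfl⟩ := Nat.exists_eq_add_of_le hik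
  rw [Nat.add_sub_cancel_left]
  have h2 : (2 : ℝ) ^ e ≠ 0 := by positivity
  have hsplit : (2 : ℝ) ^ ((i + d) * (e + 1)) = 2 ^ (i + d) * 2 ^ (e * d) * (2 ^ e) ^ i := by
    rw [← pow_mul, ← pow_add, ← pow_add]; congr 1; ring
  rw [hsplit, div_pow]
  field_simp

end Literature.Analysis.ValidatedNumerics
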